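import Literature.Analysis.FunctionSpaces.SteinExtension
import Literature.Analysis.FunctionSpaces.PoincareGluing
import Mathlib.Geometry.Manifold.PartitionOfUnity
import HarnessLib

/-!
# Gluing of Sobolev extension operators along a finite chart cover (discharge)

`Literature.Analysis.FunctionSpaces.SteinExtension` records as the named fact
`Literature.Analysis.FunctionSpaces.sobolevExtension_glue` the reduction step of Stein's extension theorem (E. M. Stein,
*Singular integrals and differentiability properties of functions* (1970), Ch. VI, §3.3.1, the
proof of Theorem 5 from Theorem 5'): if a bounded open set `Ω` is covered near its boundary by
finitely many balls `B(xᵢ, rᵢ)` in which it coincides with open sets `Dᵢ` each carrying a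
`(k,p)`-extension operator with bound `C`, then `Ω` carries one with bound `K (1 + C)`, `K`
independent of `p`, assembled by a partition of unity. This file proves it
(`Literature.Analysis.FunctionSpaces.sobolevExtension_glue_holds`), developing on the way the part of the calculus of
`W^{k,p}(Ω)` (`Literature.Analysis.FunctionSpaces.MemSobolevDomain`, `Literature.Analysis.FunctionSpaces.eSobolevDomainNorm` of `SobolevDomain`) that it needs:

* `‖·‖_{W^{k,p}} ≤ ‖·‖_{W^{k+1,p}}` (Adams, *Sobolev Spaces* (1975), ¶3.1) — the rest of the
  elementary calculus used here (`W^{k+1,p} ⊆ W^{k,p}`, the triangle inequality, congruence on `Ω`,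
  the norm at a given weak derivative) is imported from `SobolevTraceDensityHigherProofs`
  (`Literature.SobolevApprox.*`) and `MeyersSerrinProofs` (`Literature.MeyersSerrin.*`), not re-proved;
* the **Leibniz rule of order `k`**: for `ζ ∈ C_c^∞(E')` there is `A = A(ζ, k)` with
  `‖ζ f‖_{W^{k,p}(Ω)} ≤ A ‖f‖_{W^{k,p}(Ω)}` for all `p ≥ 1`, `Ω`, `μ`, `f` (Adams 1975, ¶1.58;
  Evans, *PDE*, §5.2.3, Theorem 1 (iv)), by induction from the first-order product rule
  `Literature.Analysis.FunctionSpaces.SobolevApprox.hasWeakFDerivOn_smul`;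
* the **Leibniz rule with extension by zero**: if moreover `tsupport ζ ∩ Ω' ⊆ Ω`, then the
  zero extension `𝟙_Ω (ζ f)` lies in `W^{k,p}(Ω')` with the same kind of bound, its weak
  derivative on `Ω'` being `𝟙_Ω (ζ Df + Dζ ⊗ f)` (Adams 1975, ¶1.58 with Lemma 3.22:
  functions of `W^{m,p}(Ω)` vanishing near `∂Ω` extend by zero; the test function `φ` on `Ω'`
  is replaced by the test function `ζ φ` on `Ω`). The *qualitative* statements (membership
  only) are `Literature.Analysis.FunctionSpaces.SobolevApprox.memSobolevDomain_smul` / `memSobolevDomain_indicator_smul` of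
  `SobolevTraceDensityHigherProofs`; the gluing needs the *quantitative* form with a constant
  `A(ζ, k)` uniform in `p`, `Ω`, `μ`, `f`, which requires carrying the explicit weak derivatives
  through the induction, so the two Leibniz rules are re-derived here in that form (from the
  same first-order rule `SobolevApprox.hasWeakFDerivOn_smul`).

## Proof of the gluing (Stein, Ch. VI, §3.3.1, finite cover)

With a smooth partition of unity `Σᵢ θᵢ + θ₋ = 1` on `Ω̄` subordinate to the half-balls
`B(xᵢ, rᵢ/2)` and to `Ω` (Mathlib's `SmoothPartitionOfUnity.exists_isSubordinate`) and bump
functions `θ̃ᵢ = 1` on `B̄(xᵢ, rᵢ/2)` supported in `B(xᵢ, 3rᵢ/4)`, put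
`combine ext f = Σᵢ θ̃ᵢ • extᵢ (𝟙_Ω θᵢ f) + 𝟙_Ω θ₋ f`. On `Ω` this is `Σᵢ θᵢ f + θ₋ f = f`,
because `extᵢ h = h` on `Dᵢ ⊇ Ω ∩ B(xᵢ, rᵢ)` and `θ̃ᵢ = 0 = θᵢ` off `B(xᵢ, rᵢ)`. Each
`hᵢ = 𝟙_Ω θᵢ f` lies in `W^{k,p}(Dᵢ)` with norm `≤ A(θᵢ) ‖f‖` (Leibniz rule with extension by
zero, as `tsupport θᵢ ∩ Dᵢ ⊆ B(xᵢ, rᵢ) ∩ Dᵢ ⊆ Ω`), so `θ̃ᵢ extᵢ hᵢ ∈ W^{k,p}(E')` with norm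
`≤ A(θ̃ᵢ) C A(θᵢ) ‖f‖`; and `𝟙_Ω θ₋ f ∈ W^{k,p}(E')` with norm `≤ A(θ₋) ‖f‖`
(`tsupport θ₋ ⊆ Ω`). Summing, `K = Σᵢ A(θ̃ᵢ) A(θᵢ) + A(θ₋)` works for every `p`.

## References

* E. M. Stein, *Singular Integrals and Differentiability Properties of Functions* (1970),
  Ch. VI, §3.3.1, (31)–(32).
* R. A. Adams, *Sobolev Spaces*, Academic Press (1975), ¶1.57–1.58, ¶2.1, ¶3.1–3.2,
  Lemma 3.22 (p. 67), ¶4.24.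
* H. Brezis, *Functional Analysis, Sobolev Spaces and PDE* (2011), §9.1, Proposition 9.1.
* L. C. Evans, *Partial Differential Equations*, 2nd ed. (2010), §5.2.3, Theorem 1.
-/

noncomputable section

open MeasureTheory TopologicalSpace Filter Set Metric Bornology Function
open scoped ENNReal NNReal ContDiff Topology InnerProductSpace Manifold

namespace Literature.Analysis.FunctionSpaces

/-! ### Part I. `‖·‖_{W^{k,p}} ≤ ‖·‖_{W^{k+1,p}}` -/

section Calculus

variable {E' : Type*} [NormedAddCommGroup E'] [NormedSpace ℝ E'] [MeasurableSpace E']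
variable {F : Type*} [NormedAddCommGroup F] [NormedSpace ℝ F]

/-- `‖f‖_{W^{k,p}(Ω)} ≤ ‖f‖_{W^{k+1,p}(Ω)}` (Adams, *Sobolev Spaces* (1975), ¶3.1). [folklore] -/
theorem eSobolevDomainNorm_le_succ [FiniteDimensional ℝ E'] {k : ℕ} {p : ℝ≥0∞} {Ω : Opens E'}
    {μ : Measure E'} {f : E' → F} :
    eSobolevDomainNorm k p Ω μ f ≤ eSobolevDomainNorm (k + 1) p Ω μ f := by
  induction k generalizing f with
  | zero => exact eLpNorm_le_eSobolevDomainNorm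
  | succ k ih =>
    rw [eSobolevDomainNorm_succ, eSobolevDomainNorm_succ (k := k + 1)]
    exact add_le_add le_rfl (iInf₂_mono fun g _ => Finset.sum_le_sum fun i _ => ih)

end Calculus

/-! ### Part II. The Leibniz rule of order `k` -/

section Leibniz

variable {E' : Type*} [NormedAddCommGroup E'] [NormedSpace ℝ E'] [MeasurableSpace E']
  [FiniteDimensional ℝ E'] [BorelSpace E']
variable {F : Type*} [NormedAddCommGroup F] [NormedSpace ℝ F] [CompleteSpace F]

/-- **Leibniz rule of order `k` in `W^{k,p}(Ω)`** (Adams, *Sobolev Spaces* (1975), ¶1.58: for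
`ω ∈ C^∞(Ω)`, "the Leibniz rule is easily checked to hold for `D^α(ωT)`"; Evans, *PDE*, §5.2.3,
Theorem 1 (iv): `ζ u ∈ W^{k,p}(U)` with `D^α(ζu) = Σ_{β ≤ α} (α choose β) D^β ζ D^{α-β} u`). For a
smooth compactly supported `ζ` and `k : ℕ` there is a constant `A` (depending only on `ζ` and
`k`: sup norms of derivatives of `ζ` of order `≤ k` and the dimension) such that for every
`1 ≤ p ≤ ∞`, every open `Ω`, every measure `μ` and every `f ∈ W^{k,p}(Ω)`:
`ζ f ∈ W^{k,p}(Ω)` and `‖ζ f‖_{W^{k,p}(Ω)} ≤ A ‖f‖_{W^{k,p}(Ω)}`. By induction on `k` from the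
first-order product rule `D(ζ f) = ζ Df + Dζ ⊗ f` (`SobolevApprox.hasWeakFDerivOn_smul`), whose
components `ζ (Df v) + (∂_v ζ) f` are handled by the induction hypothesis for `ζ` and for
`∂_v ζ ∈ C_c^∞`, and the triangle inequality. [cite: Adams1975, ¶1.58 (Leibniz rule)] -/
theorem exists_eSobolevDomainNorm_smul_le (k : ℕ) {ζ : E' → ℝ} (hζ : ContDiff ℝ ∞ ζ)
    (hζc : HasCompactSupport ζ) :
    ∃ A : ℝ≥0, ∀ (p : ℝ≥0∞) (Ω : Opens E') (μ : Measure E') (f : E' → F), 1 ≤ p →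
      MemSobolevDomain k p Ω μ f →
        MemSobolevDomain k p Ω μ (fun x => ζ x • f x) ∧
          eSobolevDomainNorm k p Ω μ (fun x => ζ x • f x) ≤ A * eSobolevDomainNorm k p Ω μ f := by
  induction k generalizing ζ with
  | zero =>
    obtain ⟨C, hC⟩ := hζ.continuous.bounded_above_of_compact_support hζc
    refine ⟨(max C 0).toNNReal, fun p Ω μ f hp hf => ?_⟩
    rw [memSobolevDomain_zero_iff] at hf
    have hle : ∀ x, ‖ζ x • f x‖ ≤ max C 0 * ‖f x‖ := fun x => by
      rw [norm_smul]
      exact mul_le_mul_of_nonneg_right ((hC x).trans (le_max_left _ _)) (norm_nonneg _)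
    have hmeas : AEStronglyMeasurable (fun x => ζ x • f x) (μ.restrict Ω) :=
      hζ.continuous.aestronglyMeasurable.smul hf.1
    refine ⟨(memSobolevDomain_zero_iff).2 (hf.of_le_mul hmeas (Eventually.of_forall hle)), ?_⟩
    rw [eSobolevDomainNorm_zero, eSobolevDomainNorm_zero]
    exact (eLpNorm_le_mul_eLpNorm_of_ae_le_mul (Eventually.of_forall hle) p).trans le_rfl
  | succ k ih =>
    set b := Module.finBasis ℝ E' with hb_def
    -- derivatives of `ζ` along arbitrary directions are again `C_c^∞`
    have hdζ : ∀ v : E', ContDiff ℝ ∞ fun x => fderiv ℝ ζ x v := fun v =>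
      (hζ.fderiv_right (m := ∞) (by norm_cast)).clm_apply contDiff_const
    have hdζc : ∀ v : E', HasCompactSupport fun x => fderiv ℝ ζ x v := fun v =>
      hζc.fderiv_apply (𝕜 := ℝ) v
    -- the constants: for `ζ` at order `k`, for `∂ⱼ ζ` at order `k`, and `sup |ζ|`
    obtain ⟨A₀, hA₀⟩ := ih hζ hζc
    choose A' hA' using fun j => ih (hdζ (b j)) (hdζc (b j))
    obtain ⟨C, hC⟩ := hζ.continuous.bounded_above_of_compact_support hζc
    refine ⟨(max C 0).toNNReal + A₀ + ∑ j, A' j, fun p Ω μ f hp hf => ?_⟩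
    obtain ⟨hf0, g, hg, hgk⟩ := hf
    have hfk : MemSobolevDomain k p Ω μ f := SobolevApprox.memSobolevDomain_of_succ ⟨hf0, g, hg, hgk⟩
    -- the weak derivative of `ζ f` and its components
    have hG := SobolevApprox.hasWeakFDerivOn_smul (μ := μ) hg hζ
    have hcomp : ∀ v : E', (fun x => (ζ x • g x + (fderiv ℝ ζ x).smulRight (f x)) v) =
        (fun x => ζ x • g x v) + fun x => fderiv ℝ ζ x v • f x := fun v => by
      funext x
      simp only [_root_.add_apply, FunLike.coe_smul, Pi.smul_apply,
        ContinuousLinearMap.smulRight_apply, Pi.add_apply]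
    -- `L^p` part
    have hle : ∀ x, ‖ζ x • f x‖ ≤ max C 0 * ‖f x‖ := fun x => by
      rw [norm_smul]
      exact mul_le_mul_of_nonneg_right ((hC x).trans (le_max_left _ _)) (norm_nonneg _)
    have hmeas : AEStronglyMeasurable (fun x => ζ x • f x) (μ.restrict Ω) :=
      hζ.continuous.aestronglyMeasurable.smul hf0.1
    have hLp : eLpNorm (fun x => ζ x • f x) p (μ.restrict Ω) ≤
        (max C 0).toNNReal * eLpNorm f p (μ.restrict Ω) := by
      exact (eLpNorm_le_mul_eLpNorm_of_ae_le_mul (Eventually.of_forall hle) p).trans le_rfl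
    -- membership
    have hmem : MemSobolevDomain (k + 1) p Ω μ (fun x => ζ x • f x) := by
      refine ⟨hf0.of_le_mul hmeas (Eventually.of_forall hle), _, hG, fun v => ?_⟩
      rw [hcomp v]
      obtain ⟨Av, hAv⟩ := ih (hdζ v) (hdζc v)
      exact SobolevApprox.memSobolevDomain_add (hA₀ p Ω μ _ hp (hgk v)).1
        (hAv p Ω μ f hp hfk).1
    refine ⟨hmem, ?_⟩
    -- the norm bound
    rw [MeyersSerrin.eSobolevDomainNorm_succ_eq hG, MeyersSerrin.eSobolevDomainNorm_succ_eq hg]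
    set T := eLpNorm f p (μ.restrict Ω) + ∑ j, eSobolevDomainNorm k p Ω μ (fun x => g x (b j))
      with hT_def
    have hT : eSobolevDomainNorm (k + 1) p Ω μ f = T := by
      rw [hT_def, MeyersSerrin.eSobolevDomainNorm_succ_eq hg]
    have hfT : eSobolevDomainNorm k p Ω μ f ≤ T := hT ▸ eSobolevDomainNorm_le_succ
    have hcompT : ∀ j, eSobolevDomainNorm k p Ω μ
        (fun x => (ζ x • g x + (fderiv ℝ ζ x).smulRight (f x)) (b j)) ≤
          A₀ * eSobolevDomainNorm k p Ω μ (fun x => g x (b j)) + A' j * T := fun j => by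
      rw [hcomp (b j)]
      have h1 := hA₀ p Ω μ _ hp (hgk (b j))
      have h2 := hA' j p Ω μ f hp hfk
      refine (SobolevApprox.eSobolevDomainNorm_add_le h1.1.memLp.aestronglyMeasurable
        h2.1.memLp.aestronglyMeasurable hp).trans ?_
      exact add_le_add h1.2 (h2.2.trans (by gcongr))
    calc eLpNorm (fun x => ζ x • f x) p (μ.restrict Ω) +
          ∑ j, eSobolevDomainNorm k p Ω μ
            (fun x => (ζ x • g x + (fderiv ℝ ζ x).smulRight (f x)) (b j))
        ≤ (max C 0).toNNReal * eLpNorm f p (μ.restrict Ω) +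
          ∑ j, (A₀ * eSobolevDomainNorm k p Ω μ (fun x => g x (b j)) + A' j * T) :=
          add_le_add hLp (Finset.sum_le_sum fun j _ => hcompT j)
      _ = (max C 0).toNNReal * eLpNorm f p (μ.restrict Ω) +
          A₀ * ∑ j, eSobolevDomainNorm k p Ω μ (fun x => g x (b j)) + (∑ j, (A' j : ℝ≥0∞)) * T := by
          rw [Finset.sum_add_distrib, Finset.mul_sum, Finset.sum_mul, add_assoc]
      _ ≤ (max C 0).toNNReal * T + A₀ * T + (∑ j, (A' j : ℝ≥0∞)) * T := by
          gcongr
          · exact le_self_add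
          · exact le_add_self
      _ = (((max C 0).toNNReal + A₀ + ∑ j, A' j : ℝ≥0) : ℝ≥0∞) * T := by
          push_cast
          ring

/-- The Leibniz rule of order `k` on the whole space, extension-operator form: multiplication by
`ζ ∈ C_c^∞` maps `W^{k,p}(E')` to itself with a bound independent of `p` (Adams 1975, ¶1.58).
A restatement of `exists_eSobolevDomainNorm_smul_le` kept for readability of the gluing proof.
[folklore] -/
theorem exists_eSobolevDomainNorm_smul_le' (k : ℕ) {ζ : E' → ℝ} (hζ : ContDiff ℝ ∞ ζ)
    (hζc : HasCompactSupport ζ) :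
    ∃ A : ℝ≥0, ∀ (p : ℝ≥0∞) (Ω : Opens E') (μ : Measure E') (f : E' → F), 1 ≤ p →
      MemSobolevDomain k p Ω μ f →
        MemSobolevDomain k p Ω μ (ζ • f) ∧
          eSobolevDomainNorm k p Ω μ (ζ • f) ≤ A * eSobolevDomainNorm k p Ω μ f :=
  exists_eSobolevDomainNorm_smul_le k hζ hζc

end Leibniz

/-! ### Part III. The Leibniz rule with extension by zero -/

section Indicator

variable {E' : Type*} [NormedAddCommGroup E'] [NormedSpace ℝ E'] [MeasurableSpace E']
  [FiniteDimensional ℝ E'] [BorelSpace E']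
variable {F : Type*} [NormedAddCommGroup F] [NormedSpace ℝ F] [CompleteSpace F]

omit [MeasurableSpace E'] [FiniteDimensional ℝ E'] [BorelSpace E'] in
/-- For a smooth `ζ` whose support meets the open set `Ω'` only inside `Ω` and a test function
`φ` on `Ω'`, the product `ζ φ` is a test function on `Ω` (Adams, *Sobolev Spaces* (1975),
¶1.58; Evans, *PDE*, §5.2.1). [folklore] -/
theorem isTestFunctionOn_mul_of_tsupport_inter_subset {Ω Ω' : Opens E'} {ζ : E' → ℝ}
    (hζ : ContDiff ℝ ∞ ζ) (hζs : tsupport ζ ∩ (Ω' : Set E') ⊆ Ω) {φ : E' → ℝ}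
    (hφ : IsTestFunctionOn Ω' φ) : IsTestFunctionOn Ω fun x => ζ x * φ x where
  contDiff := hζ.mul hφ.contDiff
  hasCompactSupport := hφ.hasCompactSupport.mul_left
  tsupport_subset := fun _ hx =>
    hζs ⟨tsupport_mul_subset_left (f := ζ) (g := φ) hx,
      hφ.tsupport_subset (tsupport_mul_subset_right (f := ζ) (g := φ) hx)⟩

omit [CompleteSpace F] in
/-- **Leibniz rule with extension by zero, first order** (Adams, *Sobolev Spaces* (1975),
¶1.58, Leibniz rule `D(ωT) = ω DT + (Dω) T`, together with Lemma 3.22, p. 67: a function of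
`W^{m,p}(Ω)` vanishing near `∂Ω` extends by zero; Evans, *PDE*, §5.2.3, Theorem 1 (iv)). Let
`g` be a weak derivative of `f` on `Ω`, with the zero extensions `𝟙_Ω f`, `𝟙_Ω g` locally
integrable, and let `ζ` be smooth with `tsupport ζ ∩ Ω' ⊆ Ω`. Then on `Ω'` the zero extension
`𝟙_Ω (ζ f)` has the weak derivative `𝟙_Ω (ζ g + Dζ ⊗ f)`: for a test function `φ` on `Ω'`,
`ζ φ` is a test function on `Ω`, and `∫ ∂ᵥφ 𝟙_Ω ζ f = ∫_Ω (∂ᵥ(ζφ) - φ ∂ᵥζ) f =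
-∫_Ω φ (ζ g v + ∂ᵥζ f)`. [cite: Adams1975, ¶1.58 and Lemma 3.22] -/
theorem hasWeakFDerivOn_indicator_smul {Ω Ω' : Opens E'} {μ : Measure E'} {f : E' → F}
    {g : E' → E' →L[ℝ] F} (h : HasWeakFDerivOn Ω μ f g)
    (hfi : LocallyIntegrable ((Ω : Set E').indicator f) μ)
    (hgi : LocallyIntegrable ((Ω : Set E').indicator g) μ) {ζ : E' → ℝ}
    (hζ : ContDiff ℝ ∞ ζ) (hζs : tsupport ζ ∩ (Ω' : Set E') ⊆ Ω) :
    HasWeakFDerivOn Ω' μ ((Ω : Set E').indicator fun x => ζ x • f x)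
      ((Ω : Set E').indicator fun x => ζ x • g x + (fderiv ℝ ζ x).smulRight (f x)) where
  locallyIntegrableOn := by
    have : ((Ω : Set E').indicator fun x => ζ x • f x) =
        fun x => ζ x • (Ω : Set E').indicator f x := by
      funext x; exact indicator_smul_apply _ ζ f x
    rw [this]
    exact ((locallyIntegrableOn_univ.2 hfi).continuousOn_smul isOpen_univ.isLocallyClosed
      hζ.continuous.continuousOn).mono_set (subset_univ _)
  locallyIntegrableOn_deriv := by
    have : ((Ω : Set E').indicator fun x => ζ x • g x + (fderiv ℝ ζ x).smulRight (f x)) =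
        fun x => ζ x • (Ω : Set E').indicator g x +
          (fderiv ℝ ζ x).smulRight ((Ω : Set E').indicator f x) := by
      funext x
      by_cases hx : x ∈ (Ω : Set E')
      · simp only [indicator_of_mem hx]
      · simp only [indicator_of_notMem hx, smul_zero, ContinuousLinearMap.smulRight_zero,
          add_zero]
    rw [this]
    refine LocallyIntegrableOn.add (ε'' := E' →L[ℝ] F) ?_ ?_
    · exact (LocallyIntegrableOn.continuousOn_smul (E := E' →L[ℝ] F) isOpen_univ.isLocallyClosed
        (locallyIntegrableOn_univ.2 hgi) hζ.continuous.continuousOn).mono_set (subset_univ _)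
    · exact SobolevApprox.locallyIntegrableOn_fderiv_smulRight (Ω := Ω') (hζ.of_le (by simp))
        (hfi.locallyIntegrableOn _)
  integral_fderiv_smul_eq φ v hφ := by
    have hΩm : MeasurableSet (Ω : Set E') := Ω.isOpen.measurableSet
    have hζd : Differentiable ℝ ζ := hζ.differentiable (by simp)
    have hφd : Differentiable ℝ φ := hφ.contDiff.differentiable (by simp)
    -- off `Ω'`, the test function and its derivative vanish
    have hφ0 : ∀ x, x ∉ (Ω' : Set E') → φ x = 0 := fun x hx =>
      image_eq_zero_of_notMem_tsupport fun h' => hx (hφ.tsupport_subset h')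
    have hφ0' : ∀ x, x ∉ (Ω' : Set E') → fderiv ℝ φ x v = 0 := fun x hx => by
      rw [fderiv_of_notMem_tsupport ℝ (fun h' => hx (hφ.tsupport_subset h')),
        zero_apply]
    -- reduce both integrals to integrals over `Ω`
    have lhs : ∫ x in (Ω' : Set E'), (fderiv ℝ φ x v) • (Ω : Set E').indicator
        (fun x => ζ x • f x) x ∂μ = ∫ x in (Ω : Set E'), (ζ x * fderiv ℝ φ x v) • f x ∂μ := by
      have e1 : (fun x => (fderiv ℝ φ x v) • (Ω : Set E').indicator (fun x => ζ x • f x) x) =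
          (Ω : Set E').indicator fun x => (ζ x * fderiv ℝ φ x v) • f x := by
        funext x
        by_cases hx : x ∈ (Ω : Set E')
        · simp only [indicator_of_mem hx, smul_smul, mul_comm]
        · simp only [indicator_of_notMem hx, smul_zero]
      rw [e1, setIntegral_indicator hΩm]
      refine (setIntegral_eq_of_subset_of_forall_sdiff_eq_zero hΩm inter_subset_right ?_).symm
      rintro x ⟨hxΩ, hx⟩
      rw [hφ0' x fun h' => hx ⟨h', hxΩ⟩, mul_zero, zero_smul]
    have rhs : ∫ x in (Ω' : Set E'), φ x • (Ω : Set E').indicator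
        (fun x => ζ x • g x + (fderiv ℝ ζ x).smulRight (f x)) x v ∂μ =
        ∫ x in (Ω : Set E'), φ x • (ζ x • g x v + (fderiv ℝ ζ x v) • f x) ∂μ := by
      have e1 : (fun x => φ x • (Ω : Set E').indicator
          (fun x => ζ x • g x + (fderiv ℝ ζ x).smulRight (f x)) x v) =
          (Ω : Set E').indicator fun x => φ x • (ζ x • g x v + (fderiv ℝ ζ x v) • f x) := by
        funext x
        by_cases hx : x ∈ (Ω : Set E')
        · simp only [indicator_of_mem hx, _root_.add_apply, FunLike.coe_smul, Pi.smul_apply,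
            ContinuousLinearMap.smulRight_apply]
        · simp only [indicator_of_notMem hx, zero_apply, smul_zero]
      rw [e1, setIntegral_indicator hΩm]
      refine (setIntegral_eq_of_subset_of_forall_sdiff_eq_zero hΩm inter_subset_right ?_).symm
      rintro x ⟨hxΩ, hx⟩
      rw [hφ0 x fun h' => hx ⟨h', hxΩ⟩, zero_smul]
    rw [lhs, rhs]
    -- the Leibniz computation with the test function `ζ φ` on `Ω`
    have hψ : IsTestFunctionOn Ω (fun x => ζ x * φ x) :=
      isTestFunctionOn_mul_of_tsupport_inter_subset hζ hζs hφ
    have hψ' : ∀ x, fderiv ℝ (fun x => ζ x * φ x) x v =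
        ζ x * fderiv ℝ φ x v + φ x * fderiv ℝ ζ x v := fun x => by
      rw [fderiv_fun_mul (hζd x) (hφd x)]
      simp [smul_eq_mul]
    have key := h.integral_fderiv_smul_eq _ v hψ
    simp only [hψ'] at key
    -- integrability of the pieces on `Ω`
    have hc1 : Continuous fun x => fderiv ℝ φ x v :=
      (hφ.contDiff.continuous_fderiv (by simp)).clm_apply continuous_const
    have hc2 : Continuous fun x => fderiv ℝ ζ x v :=
      (hζ.continuous_fderiv (by simp)).clm_apply continuous_const
    have hts1 : tsupport (fun x => ζ x * fderiv ℝ φ x v) ⊆ (Ω : Set E') := fun x hx =>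
      hζs ⟨tsupport_mul_subset_left (f := ζ) (g := fun x => fderiv ℝ φ x v) hx,
        hφ.tsupport_subset ((tsupport_fderiv_apply_subset ℝ v)
          (tsupport_mul_subset_right (f := ζ) (g := fun x => fderiv ℝ φ x v) hx))⟩
    have hts2 : tsupport (fun x => φ x * fderiv ℝ ζ x v) ⊆ (Ω : Set E') := fun x hx =>
      hζs ⟨(tsupport_fderiv_apply_subset ℝ v)
          (tsupport_mul_subset_right (f := φ) (g := fun x => fderiv ℝ ζ x v) hx),
        hφ.tsupport_subset (tsupport_mul_subset_left (f := φ) (g := fun x => fderiv ℝ ζ x v) hx)⟩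
    have hts3 : tsupport (fun x => φ x * ζ x) ⊆ (Ω : Set E') := fun x hx =>
      hζs ⟨tsupport_mul_subset_right (f := φ) (g := ζ) hx,
        hφ.tsupport_subset (tsupport_mul_subset_left (f := φ) (g := ζ) hx)⟩
    have i1 : IntegrableOn (fun x => (ζ x * fderiv ℝ φ x v) • f x) (Ω : Set E') μ :=
      SobolevApprox.integrableOn_continuous_smul (hζ.continuous.mul hc1)
        ((hφ.hasCompactSupport.fderiv_apply (𝕜 := ℝ) v).mul_left) hts1 h.locallyIntegrableOn
    have i2 : IntegrableOn (fun x => (φ x * fderiv ℝ ζ x v) • f x) (Ω : Set E') μ :=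
      SobolevApprox.integrableOn_continuous_smul (hφ.contDiff.continuous.mul hc2)
        hφ.hasCompactSupport.mul_right hts2 h.locallyIntegrableOn
    have i3 : IntegrableOn (fun x => (φ x * ζ x) • g x v) (Ω : Set E') μ :=
      SobolevApprox.integrableOn_continuous_smul (hφ.contDiff.continuous.mul hζ.continuous)
        hφ.hasCompactSupport.mul_right hts3 (SobolevApprox.locallyIntegrableOn_deriv_apply h v)
    -- rewrite both sides
    have rhs' : ∫ x in (Ω : Set E'), φ x • (ζ x • g x v + (fderiv ℝ ζ x v) • f x) ∂μ =
        ∫ x in (Ω : Set E'), (φ x * ζ x) • g x v ∂μ +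
          ∫ x in (Ω : Set E'), (φ x * fderiv ℝ ζ x v) • f x ∂μ := by
      rw [← integral_add i3 i2]
      congr 1 with x
      rw [smul_add, smul_smul, smul_smul]
    rw [rhs']
    have split : ∫ x in (Ω : Set E'), (ζ x * fderiv ℝ φ x v + φ x * fderiv ℝ ζ x v) • f x ∂μ =
        ∫ x in (Ω : Set E'), (ζ x * fderiv ℝ φ x v) • f x ∂μ +
          ∫ x in (Ω : Set E'), (φ x * fderiv ℝ ζ x v) • f x ∂μ := by
      rw [← integral_add i1 i2]
      congr 1 with x
      rw [add_smul]
    rw [split] at key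
    have e3 : ∫ x in (Ω : Set E'), (ζ x * φ x) • g x v ∂μ =
        ∫ x in (Ω : Set E'), (φ x * ζ x) • g x v ∂μ := by
      congr 1 with x; rw [mul_comm]
    rw [e3] at key
    rw [eq_sub_of_add_eq key]
    abel

omit [NormedSpace ℝ E'] [FiniteDimensional ℝ E'] [BorelSpace E'] [CompleteSpace F] in
/-- An `L^p(Ω)` function (`1 ≤ p`) extends by zero to a locally integrable function.
[folklore] -/
theorem locallyIntegrable_indicator_of_memLp [OpensMeasurableSpace E'] {Ω : Opens E'}
    {μ : Measure E'} [IsLocallyFiniteMeasure μ] {G : Type*} [NormedAddCommGroup G] {p : ℝ≥0∞}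
    (hp : 1 ≤ p) {h : E' → G} (hh : MemLp h p (μ.restrict Ω)) :
    LocallyIntegrable ((Ω : Set E').indicator h) μ := by
  have : MemLp ((Ω : Set E').indicator h) p μ :=
    (memLp_indicator_iff_restrict Ω.isOpen.measurableSet).2 hh
  exact this.locallyIntegrable hp

omit [BorelSpace E'] [CompleteSpace F] in
/-- A weak derivative all of whose components along a basis lie in `L^p(Ω)` lies in `L^p(Ω)`
(as an operator-valued map; `1 ≤ p`). [folklore] -/
theorem HasWeakFDerivOn.memLp_deriv [OpensMeasurableSpace E'] {Ω : Opens E'} {μ : Measure E'}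
    {p : ℝ≥0∞} (hp : 1 ≤ p) {k : ℕ} {f : E' → F} {g : E' → E' →L[ℝ] F}
    (hg : HasWeakFDerivOn Ω μ f g) (hgk : ∀ v, MemSobolevDomain k p Ω μ fun x => g x v) :
    MemLp g p (μ.restrict Ω) := by
  have hmeas : AEStronglyMeasurable g (μ.restrict Ω) :=
    hg.locallyIntegrableOn_deriv.aestronglyMeasurable
  refine ⟨hmeas, ?_⟩
  set b := Module.finBasis ℝ E'
  refine (SobolevApprox.eLpNorm_le_mul_sum_eLpNorm_apply_basis b hmeas hp).trans_lt ?_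
  refine ENNReal.mul_lt_top ENNReal.coe_lt_top (ENNReal.sum_lt_top.2 fun i _ => ?_)
  exact (hgk (b i)).memLp.eLpNorm_lt_top

omit [FiniteDimensional ℝ E'] [BorelSpace E'] [CompleteSpace F] in
/-- `L^p` bound for the zero extension of `ζ f`: `‖𝟙_Ω (ζ f)‖_{L^p(Ω')} ≤ (sup |ζ|) ‖f‖_{L^p(Ω)}`
(Adams, *Sobolev Spaces* (1975), ¶2.1 and Lemma 3.22). [folklore] -/
theorem exists_eLpNorm_indicator_smul_le [OpensMeasurableSpace E'] {ζ : E' → ℝ}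
    (hζ : ContDiff ℝ ∞ ζ) (hζc : HasCompactSupport ζ) :
    ∃ A : ℝ≥0, ∀ (p : ℝ≥0∞) (Ω Ω' : Opens E') (μ : Measure E') (f : E' → F),
      MemLp f p (μ.restrict Ω) →
        MemLp ((Ω : Set E').indicator fun x => ζ x • f x) p (μ.restrict Ω') ∧
          eLpNorm ((Ω : Set E').indicator fun x => ζ x • f x) p (μ.restrict Ω') ≤
            A * eLpNorm f p (μ.restrict Ω) := by
  obtain ⟨C, hC⟩ := hζ.continuous.bounded_above_of_compact_support hζc
  refine ⟨(max C 0).toNNReal, fun p Ω Ω' μ f hf => ?_⟩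
  have hΩm : MeasurableSet (Ω : Set E') := Ω.isOpen.measurableSet
  have hle : ∀ x, ‖ζ x • f x‖ ≤ max C 0 * ‖f x‖ := fun x => by
    rw [norm_smul]
    exact mul_le_mul_of_nonneg_right ((hC x).trans (le_max_left _ _)) (norm_nonneg _)
  have hmeas : AEStronglyMeasurable (fun x => ζ x • f x) (μ.restrict Ω) :=
    hζ.continuous.aestronglyMeasurable.smul hf.1
  have h1 : MemLp (fun x => ζ x • f x) p (μ.restrict Ω) :=
    hf.of_le_mul hmeas (Eventually.of_forall hle)
  have h2 : MemLp ((Ω : Set E').indicator fun x => ζ x • f x) p μ :=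
    (memLp_indicator_iff_restrict hΩm).2 h1
  refine ⟨h2.restrict _, ?_⟩
  calc eLpNorm ((Ω : Set E').indicator fun x => ζ x • f x) p (μ.restrict Ω')
      ≤ eLpNorm ((Ω : Set E').indicator fun x => ζ x • f x) p μ :=
        eLpNorm_mono_measure _ Measure.restrict_le_self
    _ = eLpNorm (fun x => ζ x • f x) p (μ.restrict Ω) := eLpNorm_indicator_eq_eLpNorm_restrict hΩm
    _ ≤ (max C 0).toNNReal * eLpNorm f p (μ.restrict Ω) :=
        (eLpNorm_le_mul_eLpNorm_of_ae_le_mul (Eventually.of_forall hle) p).trans le_rfl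

/-- **Leibniz rule with extension by zero, order `k`** (Adams, *Sobolev Spaces* (1975), ¶1.58
and Lemma 3.22; Evans, *PDE*, §5.2.3, Theorem 1 (iv), iterated). For a smooth compactly
supported `ζ` and `k : ℕ` there is a constant `A` such that for all `1 ≤ p`, all open `Ω, Ω'`
with `tsupport ζ ∩ Ω' ⊆ Ω`, every locally finite measure `μ` and every `f ∈ W^{k,p}(Ω)`, the zero
extension `𝟙_Ω (ζ f)` lies in `W^{k,p}(Ω')` with `‖𝟙_Ω (ζ f)‖_{W^{k,p}(Ω')} ≤ A ‖f‖_{W^{k,p}(Ω)}`.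
By induction on `k`: the weak derivative on `Ω'` is `𝟙_Ω (ζ Df + Dζ ⊗ f)`
(`hasWeakFDerivOn_indicator_smul`), whose components `𝟙_Ω (ζ (Df v)) + 𝟙_Ω ((∂ᵥζ) f)` are of
the same form with `Df v ∈ W^{k-1,p}(Ω)`, `∂ᵥζ ∈ C_c^∞`. [cite: Adams1975, ¶1.58 and Lemma 3.22] -/
theorem exists_eSobolevDomainNorm_indicator_smul_le (k : ℕ) {ζ : E' → ℝ} (hζ : ContDiff ℝ ∞ ζ)
    (hζc : HasCompactSupport ζ) :
    ∃ A : ℝ≥0, ∀ (p : ℝ≥0∞) (Ω Ω' : Opens E') (μ : Measure E') [IsLocallyFiniteMeasure μ]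
      (f : E' → F), 1 ≤ p → tsupport ζ ∩ (Ω' : Set E') ⊆ Ω → MemSobolevDomain k p Ω μ f →
        MemSobolevDomain k p Ω' μ ((Ω : Set E').indicator fun x => ζ x • f x) ∧
          eSobolevDomainNorm k p Ω' μ ((Ω : Set E').indicator fun x => ζ x • f x) ≤
            A * eSobolevDomainNorm k p Ω μ f := by
  induction k generalizing ζ with
  | zero =>
    obtain ⟨Az, hAz⟩ := exists_eLpNorm_indicator_smul_le (F := F) hζ hζc
    refine ⟨Az, fun p Ω Ω' μ _ f _ _ hf => ?_⟩
    rw [memSobolevDomain_zero_iff] at hf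
    obtain ⟨h1, h2⟩ := hAz p Ω Ω' μ f hf
    refine ⟨(memSobolevDomain_zero_iff).2 h1, ?_⟩
    rwa [eSobolevDomainNorm_zero, eSobolevDomainNorm_zero]
  | succ k ih =>
    set b := Module.finBasis ℝ E' with hb_def
    have hdζ : ∀ v : E', ContDiff ℝ ∞ fun x => fderiv ℝ ζ x v := fun v =>
      (hζ.fderiv_right (m := ∞) (by norm_cast)).clm_apply contDiff_const
    have hdζc : ∀ v : E', HasCompactSupport fun x => fderiv ℝ ζ x v := fun v =>
      hζc.fderiv_apply (𝕜 := ℝ) v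
    have hdζs : ∀ v : E', tsupport (fun x => fderiv ℝ ζ x v) ⊆ tsupport ζ := fun v =>
      tsupport_fderiv_apply_subset ℝ v
    -- the constants
    obtain ⟨A₀, hA₀⟩ := ih hζ hζc
    choose A' hA' using fun j => ih (hdζ (b j)) (hdζc (b j))
    obtain ⟨Az, hAz⟩ := exists_eLpNorm_indicator_smul_le (F := F) hζ hζc
    refine ⟨Az + A₀ + ∑ j, A' j, fun p Ω Ω' μ _ f hp hζs hf => ?_⟩
    obtain ⟨hf0, g, hg, hgk⟩ := hf
    have hfk : MemSobolevDomain k p Ω μ f := SobolevApprox.memSobolevDomain_of_succ ⟨hf0, g, hg, hgk⟩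
    have hΩm : MeasurableSet (Ω : Set E') := Ω.isOpen.measurableSet
    -- the weak derivative of the zero extension on `Ω'`
    have hfi : LocallyIntegrable ((Ω : Set E').indicator f) μ :=
      locallyIntegrable_indicator_of_memLp hp hf0
    have hgi : LocallyIntegrable ((Ω : Set E').indicator g) μ :=
      locallyIntegrable_indicator_of_memLp hp (hg.memLp_deriv hp hgk)
    have hG := hasWeakFDerivOn_indicator_smul (Ω' := Ω') hg hfi hgi hζ hζs
    have hcomp : ∀ v : E', (fun x => (Ω : Set E').indicator
        (fun x => ζ x • g x + (fderiv ℝ ζ x).smulRight (f x)) x v) =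
        ((Ω : Set E').indicator fun x => ζ x • g x v) +
          (Ω : Set E').indicator fun x => fderiv ℝ ζ x v • f x := fun v => by
      funext x
      by_cases hx : x ∈ (Ω : Set E')
      · simp only [indicator_of_mem hx, _root_.add_apply, FunLike.coe_smul, Pi.smul_apply,
          ContinuousLinearMap.smulRight_apply, Pi.add_apply]
      · simp only [indicator_of_notMem hx, zero_apply, Pi.add_apply, add_zero]
    -- `L^p` part, via the case `k = 0`
    have h0 := hAz p Ω Ω' μ f hf0
    -- membership
    have hmem : MemSobolevDomain (k + 1) p Ω' μ ((Ω : Set E').indicator fun x => ζ x • f x) := by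
      refine ⟨(memSobolevDomain_zero_iff).1 ((memSobolevDomain_zero_iff).2 h0.1), _, hG, fun v => ?_⟩
      rw [hcomp v]
      obtain ⟨Av, hAv⟩ := ih (hdζ v) (hdζc v)
      exact SobolevApprox.memSobolevDomain_add (hA₀ p Ω Ω' μ _ hp hζs (hgk v)).1
        (hAv p Ω Ω' μ f hp ((inter_subset_inter_left _ (hdζs v)).trans hζs) hfk).1
    refine ⟨hmem, ?_⟩
    -- the norm bound
    rw [MeyersSerrin.eSobolevDomainNorm_succ_eq hG, MeyersSerrin.eSobolevDomainNorm_succ_eq hg]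
    set T := eLpNorm f p (μ.restrict Ω) + ∑ j, eSobolevDomainNorm k p Ω μ (fun x => g x (b j))
      with hT_def
    have hT : eSobolevDomainNorm (k + 1) p Ω μ f = T := by
      rw [hT_def, MeyersSerrin.eSobolevDomainNorm_succ_eq hg]
    have hfT : eSobolevDomainNorm k p Ω μ f ≤ T := hT ▸ eSobolevDomainNorm_le_succ
    have hcompT : ∀ j, eSobolevDomainNorm k p Ω' μ
        (fun x => (Ω : Set E').indicator
          (fun x => ζ x • g x + (fderiv ℝ ζ x).smulRight (f x)) x (b j)) ≤
          A₀ * eSobolevDomainNorm k p Ω μ (fun x => g x (b j)) + A' j * T := fun j => by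
      rw [hcomp (b j)]
      have h1 := hA₀ p Ω Ω' μ _ hp hζs (hgk (b j))
      have h2 := hA' j p Ω Ω' μ f hp ((inter_subset_inter_left _ (hdζs (b j))).trans hζs) hfk
      refine (SobolevApprox.eSobolevDomainNorm_add_le h1.1.memLp.aestronglyMeasurable
        h2.1.memLp.aestronglyMeasurable hp).trans ?_
      exact add_le_add h1.2 (h2.2.trans (by gcongr))
    calc eLpNorm ((Ω : Set E').indicator fun x => ζ x • f x) p (μ.restrict Ω') +
          ∑ j, eSobolevDomainNorm k p Ω' μ (fun x => (Ω : Set E').indicator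
            (fun x => ζ x • g x + (fderiv ℝ ζ x).smulRight (f x)) x (b j))
        ≤ Az * eLpNorm f p (μ.restrict Ω) +
          ∑ j, (A₀ * eSobolevDomainNorm k p Ω μ (fun x => g x (b j)) + A' j * T) := by
          refine add_le_add ?_ (Finset.sum_le_sum fun j _ => hcompT j)
          exact h0.2
      _ = Az * eLpNorm f p (μ.restrict Ω) +
          A₀ * ∑ j, eSobolevDomainNorm k p Ω μ (fun x => g x (b j)) + (∑ j, (A' j : ℝ≥0∞)) * T := by
          rw [Finset.sum_add_distrib, Finset.mul_sum, Finset.sum_mul, add_assoc]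
      _ ≤ Az * T + A₀ * T + (∑ j, (A' j : ℝ≥0∞)) * T := by
          gcongr
          · exact le_self_add
          · exact le_add_self
      _ = ((Az + A₀ + ∑ j, A' j : ℝ≥0) : ℝ≥0∞) * T := by
          push_cast
          ring

end Indicator

/-! ### Part IV. The gluing along a finite chart cover -/

section Glue

variable {E' : Type*} [NormedAddCommGroup E'] [InnerProductSpace ℝ E'] [MeasurableSpace E']
  [FiniteDimensional ℝ E']
variable {F : Type*} [NormedAddCommGroup F] [NormedSpace ℝ F]

/-- **Discharge of `Literature.Analysis.FunctionSpaces.sobolevExtension_glue`** (Stein, *Singular integrals* (1970), Ch. VI,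
§3.3.1, (31)–(32), for a finite cover): with a smooth partition of unity `Σᵢ θᵢ + θ₋ = 1` on
`Ω̄` subordinate to the half-balls `B(xᵢ, rᵢ/2)` and to `Ω`, and bumps `θ̃ᵢ = 1` on
`B̄(xᵢ, rᵢ/2)` supported in `B(xᵢ, 3rᵢ/4)`, the operator
`combine ext f = Σᵢ θ̃ᵢ • extᵢ (𝟙_Ω θᵢ f) + 𝟙_Ω θ₋ f` is linear, restricts to `f` on `Ω`, and
maps `W^{k,p}(Ω)` to `W^{k,p}(E')` with bound `K (1 + C)`,
`K = Σᵢ A(θ̃ᵢ) A(θᵢ) + A(θ₋)` independent of `p` (Leibniz rule with and without extension by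
zero, Parts II–III, and the triangle inequality `SobolevApprox.eSobolevDomainNorm_add_le`). [cite: SteinSingularIntegrals1970, Ch. VI §3.3.1 (31)–(32) (finite cover)] -/
theorem sobolevExtension_glue_holds : sobolevExtension_glue (E' := E') (F := F) := by
  intro _ _ Ω hb k m x r hr D hcov hchart μ _
  have hΩm : MeasurableSet (Ω : Set E') := Ω.isOpen.measurableSet
  -- the open cover of `closure Ω` indexed by `Option (Fin m)`: `Ω` itself and the half-balls
  let V : Option (Fin m) → Set E' := fun i => i.elim (Ω : Set E') fun i => ball (x i) (r i / 2)
  have hVo : ∀ i, IsOpen (V i) := by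
    rintro (_ | i)
    exacts [Ω.isOpen, isOpen_ball]
  have hVb : ∀ i, IsBounded (V i) := by
    rintro (_ | i)
    exacts [hb, isBounded_ball]
  have hVc : closure (Ω : Set E') ⊆ ⋃ i, V i := by
    intro y hy
    rw [closure_eq_self_union_frontier] at hy
    rcases hy with hy | hy
    · exact mem_iUnion.2 ⟨none, hy⟩
    · obtain ⟨i, hyi⟩ := mem_iUnion.1 (hcov hy)
      exact mem_iUnion.2 ⟨some i, hyi⟩
  obtain ⟨ρ, hρ⟩ := SmoothPartitionOfUnity.exists_isSubordinate (I := 𝓘(ℝ, E')) (M := E')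
    isClosed_closure V hVo hVc
  have hρs : ∀ i, ContDiff ℝ ∞ (ρ i) := fun i => contMDiff_iff_contDiff.1 (ρ i).contMDiff
  have hρc : ∀ i, HasCompactSupport (ρ i) := fun i =>
    Metric.isCompact_of_isClosed_isBounded (isClosed_tsupport _) ((hVb i).subset (hρ i))
  have hsum1 : ∀ z ∈ (Ω : Set E'), (∑ i, ρ (some i) z) + ρ none z = 1 := fun z hz => by
    have := ρ.sum_eq_one (subset_closure hz)
    rw [finsum_eq_sum_of_fintype, Fintype.sum_option] at this
    rw [add_comm]; exact this
  -- the bumps `θ̃ᵢ`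
  let η : ∀ i : Fin m, ContDiffBump (x i) := fun i =>
    ⟨r i / 2, 3 * r i / 4, half_pos (hr i), by linarith [hr i]⟩
  have hηs : ∀ i, ContDiff ℝ ∞ (η i) := fun i => (η i).contDiff
  have hηc : ∀ i, HasCompactSupport (η i) := fun i => (η i).hasCompactSupport
  -- the constants
  choose Aη hAη using fun i => exists_eSobolevDomainNorm_smul_le (F := F) k (hηs i) (hηc i)
  choose Aθ hAθ using fun i =>
    exists_eSobolevDomainNorm_indicator_smul_le (F := F) k (hρs (some i)) (hρc (some i))
  obtain ⟨Am, hAm⟩ := exists_eSobolevDomainNorm_indicator_smul_le (F := F) k (hρs none) (hρc none)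
  -- the pieces `hᵢ f = 𝟙_Ω θᵢ f` and `h₋ f = 𝟙_Ω θ₋ f`
  set h : Fin m → (E' → F) → (E' → F) := fun i f =>
    (Ω : Set E').indicator fun z => ρ (some i) z • f z with hh_def
  set hm : (E' → F) → (E' → F) := fun f => (Ω : Set E').indicator fun z => ρ none z • f z
    with hhm_def
  have h_add : ∀ i f g, h i (f + g) = h i f + h i g := fun i f g => by
    simp only [hh_def, Pi.add_apply, smul_add]
    exact indicator_add' _ _ _
  have h_smul : ∀ i (c : ℝ) f, h i (c • f) = c • h i f := fun i c f => by
    simp only [hh_def, Pi.smul_apply, smul_comm _ c]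
    rw [indicator_const_smul]
    rfl
  have hm_add : ∀ f g, hm (f + g) = hm f + hm g := fun f g => by
    simp only [hhm_def, Pi.add_apply, smul_add]
    exact indicator_add' _ _ _
  have hm_smul : ∀ (c : ℝ) f, hm (c • f) = c • hm f := fun c f => by
    simp only [hhm_def, Pi.smul_apply, smul_comm _ c]
    rw [indicator_const_smul]
    rfl
  -- the operator
  refine ⟨(∑ i, Aη i * Aθ i) + Am, fun ext f =>
    (∑ i, fun z => η i z • ext i (h i f) z) + hm f, fun ext hlin => ?_, fun p hp C ext hext => ?_⟩
  · -- linearity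
    constructor
    · intro f g
      beta_reduce
      rw [hm_add, add_add_add_comm, ← Finset.sum_add_distrib]
      congr 1
      refine Finset.sum_congr rfl fun i _ => ?_
      funext z
      rw [h_add, (hlin i).map_add]
      simp only [Pi.add_apply, smul_add]
    · intro c f
      beta_reduce
      rw [hm_smul, smul_add, Finset.smul_sum]
      congr 1
      refine Finset.sum_congr rfl fun i _ => ?_
      funext z
      rw [h_smul, (hlin i).map_smul]
      simp only [Pi.smul_apply, smul_comm c]
  · -- the extension property with bound `K (1 + C)`
    intro f hf
    set N := eSobolevDomainNorm k p Ω μ f with hN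
    -- (a) the pieces `hᵢ f ∈ W^{k,p}(Dᵢ)`
    have hts : ∀ i, tsupport (ρ (some i)) ∩ (D i : Set E') ⊆ Ω := fun i z ⟨hz1, hz2⟩ => by
      have hzb : z ∈ ball (x i) (r i) :=
        ball_subset_ball (by linarith [hr i]) (hρ (some i) hz1)
      have : z ∈ (D i : Set E') ∩ ball (x i) (r i) := ⟨hz2, hzb⟩
      rw [← hchart i] at this
      exact this.1
    have ha : ∀ i, MemSobolevDomain k p (D i) μ (h i f) ∧
        eSobolevDomainNorm k p (D i) μ (h i f) ≤ Aθ i * N := fun i =>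
      hAθ i p Ω (D i) μ f hp (hts i) hf
    -- (b) their extensions `eᵢ = extᵢ (hᵢ f)`
    have hb' : ∀ i, EqOn (ext i (h i f)) (h i f) (D i) ∧
        MemSobolevDomain k p ⊤ μ (ext i (h i f)) ∧
        eSobolevDomainNorm k p ⊤ μ (ext i (h i f)) ≤ C * (Aθ i * N) := fun i => by
      obtain ⟨h1, h2, h3⟩ := hext i (h i f) (ha i).1
      exact ⟨h1, h2, h3.trans (by gcongr; exact (ha i).2)⟩
    -- (c) the cut-off extensions `θ̃ᵢ • eᵢ`
    have hc : ∀ i, MemSobolevDomain k p ⊤ μ (fun z => η i z • ext i (h i f) z) ∧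
        eSobolevDomainNorm k p ⊤ μ (fun z => η i z • ext i (h i f) z) ≤
          Aη i * (C * (Aθ i * N)) := fun i => by
      obtain ⟨h1, h2⟩ := hAη i p ⊤ μ (ext i (h i f)) hp (hb' i).2.1
      exact ⟨h1, h2.trans (by gcongr; exact (hb' i).2.2)⟩
    -- (d) the interior piece
    have hd : MemSobolevDomain k p ⊤ μ (hm f) ∧ eSobolevDomainNorm k p ⊤ μ (hm f) ≤ Am * N :=
      hAm p Ω ⊤ μ f hp (fun z hz => hρ none hz.1) hf
    refine ⟨fun z hz => ?_, ?_, ?_⟩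
    · -- `combine ext f = f` on `Ω`
      simp only [Pi.add_apply, Finset.sum_apply]
      have hmz : hm f z = ρ none z • f z := by
        simp only [hhm_def, indicator_of_mem hz]
      have hiz : ∀ i, η i z • ext i (h i f) z = ρ (some i) z • f z := fun i => by
        by_cases hzi : dist z (x i) < r i
        · have hzD : z ∈ (D i : Set E') := by
            have : z ∈ (Ω : Set E') ∩ ball (x i) (r i) := ⟨hz, mem_ball.2 hzi⟩
            rw [hchart i] at this
            exact this.1
          rw [(hb' i).1 hzD]
          simp only [hh_def, indicator_of_mem hz]
          by_cases hρz : ρ (some i) z = 0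
          · rw [hρz, zero_smul, smul_zero]
          · have hzs : z ∈ closedBall (x i) (η i).rIn :=
              ball_subset_closedBall (hρ (some i) (subset_tsupport _ hρz))
            rw [(η i).one_of_mem_closedBall hzs, one_smul]
        · have h0 : (η i) z = 0 := (η i).zero_of_le_dist (by
            change 3 * r i / 4 ≤ dist z (x i)
            linarith [not_lt.1 hzi, hr i])
          have hρz : ρ (some i) z = 0 := by
            by_contra hne
            have := hρ (some i) (subset_tsupport _ hne)
            change z ∈ ball (x i) (r i / 2) at this
            rw [mem_ball] at this
            linarith [not_lt.1 hzi, hr i]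
          rw [h0, hρz, zero_smul, zero_smul]
      simp only [hiz, hmz, ← Finset.sum_smul, ← add_smul, hsum1 z hz, one_smul]
    · -- membership in `W^{k,p}(E')`
      exact SobolevApprox.memSobolevDomain_add (MemSobolevDomain.sum fun i _ => (hc i).1) hd.1
    · -- the norm bound
      have hmeas : ∀ i ∈ Finset.univ, AEStronglyMeasurable (fun z => η i z • ext i (h i f) z)
          (μ.restrict (⊤ : Opens E')) := fun i _ => (hc i).1.memLp.aestronglyMeasurable
      calc eSobolevDomainNorm k p ⊤ μ ((∑ i, fun z => η i z • ext i (h i f) z) + hm f)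
          ≤ eSobolevDomainNorm k p ⊤ μ (∑ i, fun z => η i z • ext i (h i f) z) +
              eSobolevDomainNorm k p ⊤ μ (hm f) :=
            SobolevApprox.eSobolevDomainNorm_add_le (Finset.aestronglyMeasurable_sum _ hmeas)
              hd.1.memLp.aestronglyMeasurable hp
        _ ≤ ∑ i, eSobolevDomainNorm k p ⊤ μ (fun z => η i z • ext i (h i f) z) +
              eSobolevDomainNorm k p ⊤ μ (hm f) :=
            add_le_add (SobolevApprox.eSobolevDomainNorm_sum_le _ hmeas hp) le_rfl
        _ ≤ ∑ i, (Aη i : ℝ≥0∞) * (C * (Aθ i * N)) + Am * N :=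
            add_le_add (Finset.sum_le_sum fun i _ => (hc i).2) hd.2
        _ ≤ ∑ i, (1 + C : ℝ≥0∞) * (Aη i * Aθ i) * N + (1 + C) * Am * N := by
            refine add_le_add (Finset.sum_le_sum fun i _ => ?_) ?_
            · calc (Aη i : ℝ≥0∞) * (C * (Aθ i * N)) = C * (Aη i * Aθ i) * N := by ring
                _ ≤ (1 + C) * (Aη i * Aθ i) * N := by gcongr; exact le_add_self
            · calc (Am : ℝ≥0∞) * N = 1 * Am * N := by rw [one_mul]
                _ ≤ (1 + C) * Am * N := by gcongr; exact le_self_add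
        _ = (((∑ i, Aη i * Aθ i) + Am) * (1 + C) : ℝ≥0) * N := by
            push_cast
            rw [← Finset.sum_mul, ← Finset.mul_sum]
            ring

end Glue

end Literature.Analysis.FunctionSpaces
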